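import Literature.NumberTheory.ConnesConsani2024.ProlateWaveCyclicPairs
import Literature.Analysis.SpecialFunctions.EulerMascheroniBounds
import HarnessLib

/-!
# Connes–Consani–Moscovici 2024, §3.3–§3.6: the even Hermite functions `h_{2n}` — PROVED identities
# (discharges of the named facts `CCM2024_eq_30_31`, `CCM2024_prop_3_2`, `CCM2024_cor_3_2`, `CCM2024_eq_21`,
# `CCM2024_prop_3_4`, `CCM2024_eq_25` of `ProlateWaveCyclicPairs.lean`)

LINE 1 — FRAMING: RH-FREE corpus literature (finite-sum / polynomial bookkeeping for the even Hermite functions; nothing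
here bears on the truth of RH); cell rh-crit, corpus C1, seat t14 (discharge flip; facts typed by seat t12); bears_on:
W-C/W-P (sequel, no leaf role).  WHAT THIS IS NOT: any claim about RH, any new named fact — this file only PROVES facts
already typed (the four `def`s below are honest definitions with bodies: the coefficients / polynomial part of (21), the
scaling operator on polynomial parts, and the linear map `P ↦ P(x)e^{−πx²}`).

Source: A. Connes, C. Consani, H. Moscovici, *Zeta zeros and prolate wave operators*, Ann. Funct. Anal. 15 (2024) =
arXiv:2310.18423 [bib: `ConnesConsaniMoscovici2024`] (held text `paper:arxiv-2310.18423`), §3.3 Prop. 3.2 p. 11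
(chunk p0008:L107–L121), Thm. 3.1 p. 10 (p0008:L23), Prop. 3.3 (proof) eq. (25) p. 12 (p0009:L44–L59), Prop. 3.4
p. 13 (p0009:L96–L104), §3.6 p. 14 eqs. (29)–(31) (p0010:L25–L50).  Calculus on the Gaussian core `{P(x)e^{−πx²}}`
(`hasDerivAt_gaussPolyFn`, `scalingOpFun_gaussPolyFn`) is REUSED from seat t12's `ProlateWaveCyclicPairs.lean`, as are the
Hermite polynomials `hermiteR` and their Gaussian orthogonality (`Literature/Probability/Distributions/HermiteGaussian.lean`)
and the bounds `2/(2a+1) ≤ log(1 + 1/a) ≤ (2a+1)/(2a(a+1))` (`Literature/Analysis/SpecialFunctions/EulerMascheroniBounds.lean`).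

## Part 1 — eqs. (30)–(31) (`CCM2024_eq_30_31`)

Printed argument, followed verbatim: "One has `h_{2n}(0) = (−1)ⁿ 2^{1/4−n}√((2n)!)/n!`. Thus one gets (30)" — i.e.
subtracting `(h_{4ℓ}(0)/h_0(0))h_0` from the expansion (21) of `h_{4ℓ}` removes exactly its `k = 0` term; and for (31)
"`h_2(x)/h_2(0) = e^{−πx²}(4πx²−1)`… the coefficient of `πx²e^{−πx²}((4ℓ+2)!)^{1/2}` in `h_{4ℓ+2} − (h_{4ℓ+2}(0)/h_2(0))h_2`
is … `= 2^{−2ℓ+1/4} 4ℓ/(2ℓ+1)!`", the `k = 0` terms cancelling and the `k ≥ 2` terms of (21) passing through with the sign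
`(−1)^{(2ℓ+1)−k} = −(−1)ᵏ`.

## Part 2 — Proposition 3.2 (`CCM2024_prop_3_2`)

Printed proof (p0008:L118–L121), followed: "The Hermite functions (21) are eigenfunctions for the operator `𝐇` … the
eigenvalues are `2π(4n+1)`.  The subspace `E_n ⊂ L²(ℝ)^{ev}` linear span of the vectors `𝕊ʲξ_∞` for `j ≤ n` is formed of
the even functions `e^{−πx²}P(x)` where `P(x)` is an even polynomial of degree `≤ 2n`.  It coincides with the linear span
of the functions `h_{2j}`, `0 ≤ j ≤ n`."  Formalisation: write `h_{2n} = H_n(x)e^{−πx²}` with the explicit even polynomial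
`H_n = Σ_k c_{n,k} X^{2k}` of (21) (`evenHermitePoly`); the eigen-equation is the polynomial Hermite ODE
`H_n'' − 4πX H_n' + 8πn H_n = 0`, checked on coefficients through the recurrence
`c_{n,k+1}(2k+2)(2k+1) = −8π(n−k)c_{n,k}` (`evenHermiteCoeff_succ`); `𝕊(P e^{−πx²}) = (𝕊_pol P)e^{−πx²}` with
`𝕊_pol P = −i(X(P′ − 2πXP) + P/2)` raising the even degree by exactly `2` (`scalingPolyOp_X_pow`), so both families
`{𝕊_polʲ(2^{1/4})}` and `{H_j}` are TRIANGULAR in the basis `X^{2k}` with non-zero diagonal, whence the equal spans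
(`span_eq_evenSpan_of_triangular`), transported to functions along the linear map `P ↦ P(x)e^{−πx²}` (`gaussPolyLin`).

## Part 3 — eq. (21) versus `Polynomial.hermite` (`CCM2024_eq_21`)

"`h_n(x) = H_n(x)h_0(x)` where the `H_n` are orthogonal (and normalized) polynomials" (Thm. 3.1 p. 10): with Mathlib's
probabilists' Hermite polynomials (`Polynomial.coeff_hermite_explicit`: `coeff He_{2m+k} k = (−1)^m (2m−1)!! binom(2m+k,k)`,
odd-parity coefficients zero) the printed (21) is `h_{2n}(x) = 2^{1/4}((2n)!)^{−1/2} He_{2n}(2√π x) e^{−πx²}`, the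
coefficient match being the integer identity `2^{3k}(2n)! = (2m−1)!!·binom(2n,2k)·4ᵏ·(2k)!·m!·2ⁿ` (`n = k + m`).

## Part 4 — Proposition 3.4 (`CCM2024_prop_3_4`)

"For `n > 0` one has `1 ≤ a_n log(1 + 1/n) ≤ √3 log 2` which shows that the metric induced on `ℕ* ⊂ ℝ₊*` by the invariant
metric of the Lie group `ℝ₊*` is equivalent to the metric `d(n,m) := |φ(n) − φ(m)|`" (p. 13).  Lower half from
`log(1 + 1/n) ≥ 2/(2n+1)` and `a_n ≥ n + ½`; upper half with equality at `n = 1` (`a_1 = √3`) and, for `n ≥ 2`, from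
`log(1 + 1/n) ≤ (2n+1)/(2n(n+1))` and `25(2n+1)³ ≤ 288n²(n+1)` (`⇒ ≤ 6/5 ≤ √3 log 2`); the metric clause by telescoping
`φ(n) − φ(m) = Σ_{m<j≤n} a_j⁻¹`, `log(n+1) − log(m+1) = Σ_{m<j≤n} log(1 + 1/j)`.

## Part 5 — eq. (25) (`CCM2024_eq_25`)

Printed proof (p. 12): the highest term of `(H + ½)h_{2n}` is `c_n h_{2n+2}`, `c_n = −½√((2n+1)(2n+2))`, "which gives, using
the orthonormal property of the `h_n`, the equality (25)".  Followed in the coordinates `y = 2√π x` of the PROVED eq. (21):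
`(H + ½)h_{2n} ↔ ½(2yHe_{2n}′ − y²He_{2n} + He_{2n}) = −½He_{2n+2} + n(2n−1)He_{2n−2}` (`hermiteR_scaling_identity`), the
substitution `∫F(2√πx)dx = (2√π)⁻¹∫F`, the weight `e^{−y²/2}dy = √(2π)dγ₁`, and `∫He_mHe_k dγ₁ = k!δ_{mk}`.

## What is proved

* Part 1: `psiPlus_eq_sum` — eq. (30);  `psiMinus_eq_sum` — eq. (31);  `CCM2024_eq_30_31_holds`.
* Part 2: `deriv_gaussPolyFn` / `hermiteOpFun_gaussPolyFn` (calculus on the Gaussian core, over seat t12's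
  `hasDerivAt_gaussPolyFn` / `scalingOpFun_gaussPolyFn`), `toC_evenHermiteFn`, `evenHermiteCoeff_succ`, `evenHermitePoly_ode`,
  `hermiteOpFun_evenHermiteFn` (`𝐇 h_{2n} = 2π(4n+1)h_{2n}`), `span_evenHermitePoly`, `scalingPolyOp_X_pow`,
  `scalingOpFun_iterate_gaussPolyFn`, `span_scalingPolyOp_iterate`, `span_scalingOpFun_iterate_hermiteH0`,
  `span_gaussPolyFn_eq_span_evenHermiteFn`, `CCM2024_prop_3_2_holds`.
* Part 2 (cont.): `CCM2024_cor_3_2_holds` (one line over seat t12's `CCM2024_cor_3_2_of_prop_3_2`).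
* Part 3: `evenHermiteFn_eq_hermiteR`, `CCM2024_eq_21_holds`.
* Part 4: `scalingJacobiA_sq`, `scalingJacobiA_pos`, `one_le_scalingJacobiA_mul_log`, `scalingJacobiA_mul_log_le`,
  `inv_scalingJacobiA_le_log`, `spectralPhi_scalingJacobiA_succ`, `spectralPhi_sub_bounds`, `spectralPhi_abs_sub_bounds`,
  `CCM2024_prop_3_4_holds`.
* Part 5: `hermiteR_scaling_identity`, `hasDerivAt_evenHermiteFn`, `integral_scaling_hermiteR`, `CCM2024_eq_25_holds`.
-/

noncomputable section

open Finset Real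
open scoped Nat

namespace Literature.NumberTheory.ConnesConsani2024

open Literature.NumberTheory.LFunctions

section Eq3031

/-- The `k`-th summand of the printed expansion (21) of `h_{2n}` (plumbing; `evenHermiteFn n x = Σ_{k ≤ n} hermTerm n k x`).
[folklore] -/
private theorem evenHermiteFn_eq_sum (n : ℕ) (x : ℝ) :
    evenHermiteFn n x = ∑ k ∈ range (n + 1),
      (-1 : ℝ) ^ (n - k) * ((2 : ℝ) ^ (1 / 4 : ℝ) * 2 ^ (3 * k) / 2 ^ n) * Real.sqrt ((2 * n)! : ℝ) /
        (((2 * k)! : ℝ) * ((n - k)! : ℝ)) * π ^ k * x ^ (2 * k) * Real.exp (-π * x ^ 2) := rfl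

/-- Reindexing `Σ_{k = a+1}^{a+n} f(k) = Σ_{j < n} f(a+1+j)` (plumbing). [folklore] -/
private theorem sum_Icc_shift (f : ℕ → ℝ) (a n : ℕ) :
    ∑ k ∈ Icc (a + 1) (a + n), f k = ∑ k ∈ range n, f (a + 1 + k) := by
  have h : Icc (a + 1) (a + n) = Ico (a + 1) (a + 1 + n) := by
    ext k; simp only [mem_Icc, mem_Ico]; omega
  rw [h, Finset.sum_Ico_eq_sum_range, show a + 1 + n - (a + 1) = n by omega]

/-- `(−1)^{a−b} = (−1)ᵇ` for `a` even, `b ≤ a` (plumbing). [folklore] -/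
private theorem neg_one_pow_sub_of_even {a b : ℕ} (h : b ≤ a) (ha : Even a) : (-1 : ℝ) ^ (a - b) = (-1) ^ b := by
  have h1 : (-1 : ℝ) ^ (a - b) * (-1) ^ b = 1 := by rw [← pow_add, Nat.sub_add_cancel h, ha.neg_one_pow]
  have h2 : ((-1 : ℝ) ^ b) * (-1) ^ b = 1 := by rw [← pow_add, ← two_mul, pow_mul, neg_one_sq, one_pow]
  nlinarith [h1, h2, sq_nonneg ((-1 : ℝ) ^ (a - b) - (-1) ^ b)]

/-- `(−1)^{a−b} = −(−1)ᵇ` for `a` odd, `b ≤ a` (plumbing). [folklore] -/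
private theorem neg_one_pow_sub_of_odd {a b : ℕ} (h : b ≤ a) (ha : Odd a) : (-1 : ℝ) ^ (a - b) = -(-1) ^ b := by
  have h1 : (-1 : ℝ) ^ (a - b) * (-1) ^ b = -1 := by rw [← pow_add, Nat.sub_add_cancel h, ha.neg_one_pow]
  have h2 : ((-1 : ℝ) ^ b) * (-1) ^ b = 1 := by rw [← pow_add, ← two_mul, pow_mul, neg_one_sq, one_pow]
  nlinarith [h1, h2, sq_nonneg ((-1 : ℝ) ^ (a - b) + (-1) ^ b)]

/-- `2^{1/4} ≠ 0` (plumbing). [folklore] -/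
private theorem two_rpow_quarter_ne_zero : (2 : ℝ) ^ (1 / 4 : ℝ) ≠ 0 := (Real.rpow_pos_of_pos two_pos _).ne'

/-- **Eq. (30)** (§3.6 p. 14, p0010:L36): `ψ⁺_ℓ(x) = Σ_{k=1}^{2ℓ} (−1)ᵏ 2^{−2ℓ+3k+1/4}((4ℓ)!)^{1/2}/((2ℓ−k)!(2k)!) πᵏx^{2k}e^{−πx²}`.
[cite: ConnesConsaniMoscovici2024, §3.6 eq. (30) p. 14 (p0010:L36)] -/
theorem psiPlus_eq_sum (ℓ : ℕ) (x : ℝ) :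
    psiPlus ℓ x =
      ∑ k ∈ Finset.Icc 1 (2 * ℓ),
        (-1 : ℝ) ^ k * ((2 : ℝ) ^ (1 / 4 : ℝ) * 2 ^ (3 * k) / 2 ^ (2 * ℓ)) * Real.sqrt ((4 * ℓ)! : ℝ) /
          (((2 * ℓ - k)! : ℝ) * ((2 * k)! : ℝ)) * π ^ k * x ^ (2 * k) * Real.exp (-π * x ^ 2) := by
  have h4 : 2 * (2 * ℓ) = 4 * ℓ := by ring
  rw [psiPlus, evenHermiteFn_apply_zero, evenHermiteFn_eq_sum, Finset.sum_range_succ', h4,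
    show Finset.Icc 1 (2 * ℓ) = Finset.Icc (0 + 1) (0 + 2 * ℓ) by rw [zero_add, zero_add], sum_Icc_shift]
  -- the `k = 0` term equals the subtracted multiple of `h_0`
  have h0 : (-1 : ℝ) ^ (2 * ℓ - 0) * ((2 : ℝ) ^ (1 / 4 : ℝ) * 2 ^ (3 * 0) / 2 ^ (2 * ℓ)) *
        Real.sqrt ((4 * ℓ)! : ℝ) / (((2 * 0)! : ℝ) * ((2 * ℓ - 0)! : ℝ)) * π ^ 0 * x ^ (2 * 0) *
        Real.exp (-π * x ^ 2) =
      (-1 : ℝ) ^ (2 * ℓ) * ((2 : ℝ) ^ (1 / 4 : ℝ) / 2 ^ (2 * ℓ)) * Real.sqrt ((4 * ℓ)! : ℝ) / ((2 * ℓ)! : ℝ) /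
        hermiteH0 0 * hermiteH0 x := by
    have h2 := two_rpow_quarter_ne_zero
    simp only [hermiteH0, Nat.sub_zero, mul_zero, Nat.factorial_zero, Nat.cast_one, one_mul, pow_zero, mul_one,
      pow_mul, neg_one_sq, one_pow]
    have e0 : Real.exp (-π * (0 : ℝ) ^ 2) = 1 := by simp
    rw [e0]
    field_simp
  rw [h0, add_sub_cancel_right]
  refine Finset.sum_congr rfl fun k hk => ?_
  have hk' : k + 1 ≤ 2 * ℓ := by have := Finset.mem_range.mp hk; omega
  rw [neg_one_pow_sub_of_even hk' (even_two_mul ℓ), show 0 + 1 + k = k + 1 by ring]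
  ring

/-- **Eq. (31)** (§3.6 p. 14, p0010:L48): `ψ⁻_ℓ(x) = (−ℓ 2^{−2ℓ+9/4}((4ℓ+2)!)^{1/2}/(2ℓ+1)! · πx²
 + Σ_{k=2}^{2ℓ+1} (−1)ᵏ 2^{3k−2ℓ−1+1/4}((4ℓ+2)!)^{1/2}/((2ℓ+1−k)!(2k)!) πᵏx^{2k}) e^{−πx²}`.
[cite: ConnesConsaniMoscovici2024, §3.6 eq. (31) p. 14 (p0010:L48)] -/
theorem psiMinus_eq_sum (ℓ : ℕ) (x : ℝ) :
    psiMinus ℓ x =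
      (-(ℓ * ((2 : ℝ) ^ (1 / 4 : ℝ) * 2 ^ 2 / 2 ^ (2 * ℓ)) * Real.sqrt ((4 * ℓ + 2)! : ℝ) /
            ((2 * ℓ + 1)! : ℝ)) * (π * x ^ 2) +
        ∑ k ∈ Finset.Icc 2 (2 * ℓ + 1),
          (-1 : ℝ) ^ k * ((2 : ℝ) ^ (1 / 4 : ℝ) * 2 ^ (3 * k) / 2 ^ (2 * ℓ + 1)) *
            Real.sqrt ((4 * ℓ + 2)! : ℝ) / ((((2 * ℓ + 1 - k)! : ℝ)) * ((2 * k)! : ℝ)) * π ^ k *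
              x ^ (2 * k)) * Real.exp (-π * x ^ 2) := by
  have h4 : 2 * (2 * ℓ + 1) = 4 * ℓ + 2 := by ring
  have h2 := two_rpow_quarter_ne_zero
  have hfac : ((2 * ℓ + 1)! : ℝ) = (2 * ℓ + 1) * ((2 * ℓ)! : ℝ) := by
    rw [Nat.factorial_succ]; push_cast; ring
  have hfne : ((2 * ℓ)! : ℝ) ≠ 0 := Nat.cast_ne_zero.mpr (Nat.factorial_ne_zero _)
  -- expand `h_{4ℓ+2}` into its `k = 0`, `k = 1` and `k ≥ 2` parts, and `h_2` completely
  rw [psiMinus, evenHermiteFn_apply_zero, evenHermiteFn_apply_zero, evenHermiteFn_eq_sum (2 * ℓ + 1),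
    Finset.sum_range_succ', Finset.sum_range_succ', evenHermiteFn_eq_sum 1, h4,
    show Finset.Icc 2 (2 * ℓ + 1) = Finset.Icc (1 + 1) (1 + 2 * ℓ) by rw [add_comm 1 (2 * ℓ)], sum_Icc_shift]
  -- the tail sums agree term by term
  have htail : ∑ k ∈ range (2 * ℓ),
      (-1 : ℝ) ^ (2 * ℓ + 1 - (k + 1 + 1)) * ((2 : ℝ) ^ (1 / 4 : ℝ) * 2 ^ (3 * (k + 1 + 1)) / 2 ^ (2 * ℓ + 1)) *
        Real.sqrt ((4 * ℓ + 2)! : ℝ) / (((2 * (k + 1 + 1))! : ℝ) * ((2 * ℓ + 1 - (k + 1 + 1))! : ℝ)) *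
        π ^ (k + 1 + 1) * x ^ (2 * (k + 1 + 1)) * Real.exp (-π * x ^ 2) =
      ∑ k ∈ range (2 * ℓ),
        -((-1 : ℝ) ^ (1 + 1 + k) * ((2 : ℝ) ^ (1 / 4 : ℝ) * 2 ^ (3 * (1 + 1 + k)) / 2 ^ (2 * ℓ + 1)) *
          Real.sqrt ((4 * ℓ + 2)! : ℝ) / (((2 * ℓ + 1 - (1 + 1 + k))! : ℝ) * ((2 * (1 + 1 + k))! : ℝ)) *
          π ^ (1 + 1 + k) * x ^ (2 * (1 + 1 + k)) * Real.exp (-π * x ^ 2)) := by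
    refine Finset.sum_congr rfl fun k hk => ?_
    have hk' : k + 1 + 1 ≤ 2 * ℓ + 1 := by have := Finset.mem_range.mp hk; omega
    rw [neg_one_pow_sub_of_odd hk' (odd_two_mul_add_one ℓ), show 1 + 1 + k = k + 1 + 1 by ring]
    ring
  have hfold : ∑ k ∈ range (2 * ℓ),
        -((-1 : ℝ) ^ (1 + 1 + k) * ((2 : ℝ) ^ (1 / 4 : ℝ) * 2 ^ (3 * (1 + 1 + k)) / 2 ^ (2 * ℓ + 1)) *
          Real.sqrt ((4 * ℓ + 2)! : ℝ) / (((2 * ℓ + 1 - (1 + 1 + k))! : ℝ) * ((2 * (1 + 1 + k))! : ℝ)) *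
          π ^ (1 + 1 + k) * x ^ (2 * (1 + 1 + k)) * Real.exp (-π * x ^ 2)) =
      -(∑ k ∈ range (2 * ℓ),
        (-1 : ℝ) ^ (1 + 1 + k) * ((2 : ℝ) ^ (1 / 4 : ℝ) * 2 ^ (3 * (1 + 1 + k)) / 2 ^ (2 * ℓ + 1)) *
          Real.sqrt ((4 * ℓ + 2)! : ℝ) / (((2 * ℓ + 1 - (1 + 1 + k))! : ℝ) * ((2 * (1 + 1 + k))! : ℝ)) *
          π ^ (1 + 1 + k) * x ^ (2 * (1 + 1 + k))) * Real.exp (-π * x ^ 2) := by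
    rw [Finset.sum_neg_distrib, ← Finset.sum_mul]
    exact (neg_mul _ _).symm
  rw [Finset.sum_range_succ, Finset.sum_range_succ, Finset.sum_range_zero, htail, hfold]
  generalize (∑ k ∈ range (2 * ℓ),
        (-1 : ℝ) ^ (1 + 1 + k) * ((2 : ℝ) ^ (1 / 4 : ℝ) * 2 ^ (3 * (1 + 1 + k)) / 2 ^ (2 * ℓ + 1)) *
          Real.sqrt ((4 * ℓ + 2)! : ℝ) / (((2 * ℓ + 1 - (1 + 1 + k))! : ℝ) * ((2 * (1 + 1 + k))! : ℝ)) *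
          π ^ (1 + 1 + k) * x ^ (2 * (1 + 1 + k))) = S
  simp only [Nat.sub_zero, mul_zero, mul_one, Nat.factorial_zero, Nat.factorial_one, Nat.cast_one,
    pow_zero, pow_one, zero_add, one_mul, show 2 * ℓ + 1 - 1 = 2 * ℓ by omega, show (2 * 1 : ℕ) = 2 from rfl,
    show (1 - 0 : ℕ) = 1 from rfl, show (1 - 1 : ℕ) = 0 from rfl]
  have hf2 : ((2 : ℕ)! : ℝ) = 2 := by norm_num [Nat.factorial]
  have hs2 : Real.sqrt 2 ≠ 0 := by positivity
  have e0 : Real.exp (-π * (0 : ℝ) ^ 2) = 1 := by simp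
  rw [(even_two_mul ℓ).neg_one_pow, (odd_two_mul_add_one ℓ).neg_one_pow, hfac, hf2]
  field_simp
  ring

/-- **Discharge of the named fact `CCM2024_eq_30_31`** (eqs. (30)–(31) of §3.6, typed in
`ProlateWaveCyclicPairs.lean` by seat t12): both expansions hold as printed.
[cite: ConnesConsaniMoscovici2024, §3.6 eqs. (30)–(31) p. 14 (p0010:L36, p0010:L48)] -/
theorem CCM2024_eq_30_31_holds : CCM2024_eq_30_31 :=
  ⟨psiPlus_eq_sum, psiMinus_eq_sum⟩

end Eq3031

/-! ## Part 2 — Proposition 3.2: `𝐇 h_{2n} = 2π(4n+1)h_{2n}` and the spans `E_n` -/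

section Prop32

open Polynomial Complex

/-- `deriv` form of `hasDerivAt_gaussPolyFn` (seat t12, `ProlateWaveCyclicPairs.lean`): `(Pe^{−πx²})′ = (P′ − 2πXP)e^{−πx²}`. [cite: ConnesConsaniMoscovici2024, Prop. 3.2 (proof) p. 11 (p0008:L118–L121)] -/
theorem deriv_gaussPolyFn (P : ℂ[X]) :
    deriv (gaussPolyFn P) = gaussPolyFn (derivative P - C (2 * π : ℂ) * X * P) :=
  funext fun x => (hasDerivAt_gaussPolyFn P x).deriv

/-- The Hermite operator `𝐇 = −∂² + (2πx)²` on the Gaussian core: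
`𝐇(Pe^{−πx²}) = (−P″ + 4πXP′ + 2πP)e^{−πx²}` (eq. (20)). [cite: ConnesConsaniMoscovici2024, Prop. 3.2 eq. (20)–(21) p. 11 (p0008:L112–L119)] -/
theorem hermiteOpFun_gaussPolyFn (P : ℂ[X]) :
    hermiteOpFun (gaussPolyFn P) =
      gaussPolyFn (-derivative (derivative P) + C (4 * π : ℂ) * X * derivative P + C (2 * π : ℂ) * P) := by
  funext x
  rw [hermiteOpFun, deriv_gaussPolyFn, deriv_gaussPolyFn]
  simp only [gaussPolyFn, eval_sub, eval_mul, eval_C, eval_X, eval_add, eval_neg, derivative_sub,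
    derivative_mul, derivative_C, derivative_X, zero_mul, zero_add, mul_one]
  push_cast
  ring

/-- RH-FREE. The coefficient `c_{n,k} = (−1)^{n−k} 2^{−n+3k+1/4}((2n)!)^{1/2}/((2k)!(n−k)!) πᵏ` of `x^{2k}e^{−πx²}` in the
printed expansion (21) of `h_{2n}` (so that `evenHermiteFn n x = Σ_{k ≤ n} c_{n,k} x^{2k} e^{−πx²}` by `rfl`). [cite: ConnesConsaniMoscovici2024, Prop. 3.2 (ii) eq. (21) p. 11 (p0008:L118)] -/
def evenHermiteCoeff (n k : ℕ) : ℝ :=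
  (-1 : ℝ) ^ (n - k) * ((2 : ℝ) ^ (1 / 4 : ℝ) * 2 ^ (3 * k) / 2 ^ n) * Real.sqrt ((2 * n)! : ℝ) /
      (((2 * k)! : ℝ) * ((n - k)! : ℝ)) * π ^ k

/-- RH-FREE. The polynomial part `H_n = Σ_{k ≤ n} c_{n,k} X^{2k} ∈ ℂ[X]` of `h_{2n} = H_n(x)e^{−πx²}` (eq. (21); the even
polynomial "P(x) … of degree ≤ 2n" of Prop. 3.2's proof). [cite: ConnesConsaniMoscovici2024, Prop. 3.2 (ii) eq. (21) p. 11 (p0008:L118)] -/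
def evenHermitePoly (n : ℕ) : ℂ[X] :=
  ∑ k ∈ Finset.range (n + 1), C ((evenHermiteCoeff n k : ℝ) : ℂ) * X ^ (2 * k)

/-- `h_{2n} = H_n(x)e^{−πx²}` on the Gaussian core (eq. (21) read through `gaussPolyFn`). [cite: ConnesConsaniMoscovici2024, Prop. 3.2 (ii) eq. (21) p. 11 (p0008:L118)] -/
theorem toC_evenHermiteFn (n : ℕ) : toC (evenHermiteFn n) = gaussPolyFn (evenHermitePoly n) := by
  funext x
  simp only [toC, evenHermiteFn, gaussPolyFn, evenHermitePoly, eval_finsetSum, eval_mul, eval_C, eval_pow, eval_X,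
    Finset.sum_mul, evenHermiteCoeff]
  push_cast
  rfl

/-- The coefficient recurrence of (21): `c_{n,k+1}(2k+2)(2k+1) = −8π(n−k)c_{n,k}` (`k < n`) — the coefficient form of the
Hermite ODE behind "the Hermite functions (21) are eigenfunctions for `𝐇`". [cite: ConnesConsaniMoscovici2024, Prop. 3.2 eq. (20)–(21) p. 11 (p0008:L112–L119)] -/
theorem evenHermiteCoeff_succ (n k : ℕ) (hk : k < n) :
    evenHermiteCoeff n (k + 1) * ((2 * k + 2) * (2 * k + 1)) = -(8 * π * (n - k)) * evenHermiteCoeff n k := by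
  unfold evenHermiteCoeff
  obtain ⟨m, rfl⟩ := Nat.exists_eq_add_of_lt hk
  have e1 : k + m + 1 - (k + 1) = m := by omega
  have e2 : k + m + 1 - k = m + 1 := by omega
  rw [e1, e2]
  have f1 : ((2 * (k + 1))! : ℝ) = (2 * k + 2) * (2 * k + 1) * ((2 * k)! : ℝ) := by
    rw [show 2 * (k + 1) = (2 * k + 1) + 1 by ring, Nat.factorial_succ, Nat.factorial_succ]; push_cast; ring
  have f2 : ((m + 1)! : ℝ) = (m + 1) * (m ! : ℝ) := by rw [Nat.factorial_succ]; push_cast; ring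
  rw [f1, f2, pow_succ]
  have h2 := (Real.rpow_pos_of_pos two_pos (1 / 4 : ℝ)).ne'
  have h3 : ((2 * k)! : ℝ) ≠ 0 := by positivity
  have h4 : (m ! : ℝ) ≠ 0 := by positivity
  field_simp
  push_cast
  ring

/-- The top coefficient `c_{n,n} = 2^{2n+1/4}πⁿ/((2n)!)^{1/2} ≠ 0` (so `H_n` has even degree exactly `2n`). [cite: ConnesConsaniMoscovici2024, Prop. 3.2 (ii) eq. (21) p. 11 (p0008:L118)] -/
theorem evenHermiteCoeff_self_ne_zero (n : ℕ) : evenHermiteCoeff n n ≠ 0 := by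
  unfold evenHermiteCoeff
  have h2 := (Real.rpow_pos_of_pos two_pos (1 / 4 : ℝ)).ne'
  have h3 : Real.sqrt ((2 * n)! : ℝ) ≠ 0 := by positivity
  simp only [Nat.sub_self, pow_zero, one_mul, Nat.factorial_zero, Nat.cast_one, mul_one]
  exact mul_ne_zero (div_ne_zero (mul_ne_zero (by positivity) h3) (by positivity)) (by positivity)

/-- `H_n′ = Σ_k c_{n,k}·2k·X^{2k−1}` (plumbing). [cite: ConnesConsaniMoscovici2024, Prop. 3.2 (ii) eq. (21) p. 11 (p0008:L118)] -/
theorem derivative_evenHermitePoly (n : ℕ) :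
    derivative (evenHermitePoly n) =
      ∑ k ∈ Finset.range (n + 1), C ((evenHermiteCoeff n k : ℝ) : ℂ) * (C ((2 * k : ℕ) : ℂ) * X ^ (2 * k - 1)) := by
  simp only [evenHermitePoly, derivative_sum, derivative_C_mul, derivative_X_pow]

/-- The polynomial Hermite ODE `H_n″ − 4πX H_n′ + 8πn H_n = 0` for the polynomial part of `h_{2n}` — equivalent, by
`hermiteOpFun_gaussPolyFn`, to `𝐇 h_{2n} = 2π(4n+1)h_{2n}`; proved on coefficients via `evenHermiteCoeff_succ`. [cite: ConnesConsaniMoscovici2024, Prop. 3.2 eq. (20)–(21) p. 11 (p0008:L112–L119)] -/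
theorem evenHermitePoly_ode (n : ℕ) :
    derivative (derivative (evenHermitePoly n)) - C (4 * π : ℂ) * X * derivative (evenHermitePoly n) +
        C (8 * π * n : ℂ) * evenHermitePoly n = 0 := by
  -- second derivative, re-indexed so that the `k`-th term carries `X^{2k}`
  have h2 : derivative (derivative (evenHermitePoly n)) =
      ∑ k ∈ Finset.range n, C (((evenHermiteCoeff n (k + 1) : ℝ) : ℂ) * (((2 * (k + 1) : ℕ) : ℂ) * ((2 * k + 1 : ℕ) : ℂ))) *
        X ^ (2 * k) := by
    rw [derivative_evenHermitePoly, derivative_sum, Finset.sum_range_succ']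
    have h0 : derivative (C ((evenHermiteCoeff n 0 : ℝ) : ℂ) * (C ((2 * 0 : ℕ) : ℂ) * X ^ (2 * 0 - 1))) = 0 := by simp
    rw [h0, add_zero]
    refine Finset.sum_congr rfl fun k _ => ?_
    rw [derivative_C_mul, derivative_C_mul, derivative_X_pow, show 2 * (k + 1) - 1 - 1 = 2 * k by omega,
      show 2 * (k + 1) - 1 = 2 * k + 1 by omega, ← mul_assoc, ← mul_assoc, ← C_mul, ← C_mul, mul_assoc]
  -- `4π X P'`, with the `k`-th term carrying `X^{2k}`
  have h1 : C (4 * π : ℂ) * X * derivative (evenHermitePoly n) =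
      ∑ k ∈ Finset.range (n + 1), C (4 * π * (((evenHermiteCoeff n k : ℝ) : ℂ) * ((2 * k : ℕ) : ℂ))) * X ^ (2 * k) := by
    rw [derivative_evenHermitePoly, Finset.mul_sum]
    refine Finset.sum_congr rfl fun k _ => ?_
    rcases Nat.eq_zero_or_pos k with rfl | hk
    · simp
    · have hX : (X : ℂ[X]) * X ^ (2 * k - 1) = X ^ (2 * k) := by
        rw [← pow_succ', show 2 * k - 1 + 1 = 2 * k by omega]
      calc C (4 * π : ℂ) * X * (C ((evenHermiteCoeff n k : ℝ) : ℂ) * (C ((2 * k : ℕ) : ℂ) * X ^ (2 * k - 1)))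
          = C (4 * π : ℂ) * (C ((evenHermiteCoeff n k : ℝ) : ℂ) * C ((2 * k : ℕ) : ℂ)) * (X * X ^ (2 * k - 1)) := by
            ring
        _ = _ := by rw [hX, ← C_mul, ← C_mul]
  -- `8πn P`
  have h0 : C (8 * π * n : ℂ) * evenHermitePoly n =
      ∑ k ∈ Finset.range (n + 1), C (8 * π * n * ((evenHermiteCoeff n k : ℝ) : ℂ)) * X ^ (2 * k) := by
    rw [evenHermitePoly, Finset.mul_sum]
    refine Finset.sum_congr rfl fun k _ => ?_
    rw [← mul_assoc, ← C_mul]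
  rw [h2, h1, h0, Finset.sum_range_succ, Finset.sum_range_succ]
  -- the two top terms (`k = n`) cancel
  have ht : C (8 * π * n * ((evenHermiteCoeff n n : ℝ) : ℂ)) * (X : ℂ[X]) ^ (2 * n) =
      C (4 * π * (((evenHermiteCoeff n n : ℝ) : ℂ) * ((2 * n : ℕ) : ℂ))) * X ^ (2 * n) := by
    congr 2; push_cast; ring
  rw [ht, show ∀ a b c d : ℂ[X], a - (b + c) + (d + c) = a - b + d from fun _ _ _ _ => by ring,
    ← Finset.sum_sub_distrib, ← Finset.sum_add_distrib]
  refine Finset.sum_eq_zero fun k hk => ?_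
  have hc := congrArg (fun r : ℝ => (r : ℂ)) (evenHermiteCoeff_succ n k (Finset.mem_range.mp hk))
  rw [← sub_mul, ← add_mul, ← C_sub, ← C_add]
  have : ((evenHermiteCoeff n (k + 1) : ℝ) : ℂ) * (((2 * (k + 1) : ℕ) : ℂ) * ((2 * k + 1 : ℕ) : ℂ)) -
      4 * π * (((evenHermiteCoeff n k : ℝ) : ℂ) * ((2 * k : ℕ) : ℂ)) + 8 * π * n * ((evenHermiteCoeff n k : ℝ) : ℂ) = 0 := by
    push_cast at hc ⊢
    linear_combination hc
  rw [this, C_0, zero_mul]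

/-- **Proposition 3.2, eigen-equation (PROVED)**: `𝐇 h_{2n} = 2π(4n+1) h_{2n}` ("The Hermite functions (21) are
eigenfunctions for the operator `𝐇` … and the eigenvalues are `2π(4n+1)`"). [cite: ConnesConsaniMoscovici2024, Prop. 3.2 eq. (20)–(21) p. 11 (p0008:L112–L119)] -/
theorem hermiteOpFun_evenHermiteFn (n : ℕ) (x : ℝ) :
    hermiteOpFun (toC (evenHermiteFn n)) x = 2 * π * (4 * n + 1) * (evenHermiteFn n x : ℂ) := by
  have hfun : (evenHermiteFn n x : ℂ) = gaussPolyFn (evenHermitePoly n) x := by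
    rw [← toC_evenHermiteFn]; rfl
  rw [toC_evenHermiteFn, hermiteOpFun_gaussPolyFn, hfun]
  have hode := evenHermitePoly_ode n
  have hP : -derivative (derivative (evenHermitePoly n)) + C (4 * π : ℂ) * X * derivative (evenHermitePoly n) +
      C (2 * π : ℂ) * evenHermitePoly n = C (2 * π * (4 * n + 1) : ℂ) * evenHermitePoly n := by
    rw [show C (2 * π * (4 * n + 1) : ℂ) = C (8 * π * n : ℂ) + C (2 * π : ℂ) by rw [← C_add]; congr 1; ring]
    linear_combination (-1 : ℂ[X]) * hode
  rw [hP]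
  simp only [gaussPolyFn, eval_mul, eval_C]
  ring

/-! #### Spans: triangular families of even polynomials -/

/-- A `Fin m`-indexed range is the image of `{k < m}` (plumbing). [folklore] -/
private theorem range_fin_eq_image {α : Type*} (g : ℕ → α) (m : ℕ) :
    (Set.range fun k : Fin m => g k) = g '' Set.Iio m := by
  ext y
  constructor
  · rintro ⟨k, rfl⟩; exact ⟨k, k.2, rfl⟩
  · rintro ⟨k, hk, rfl⟩; exact ⟨⟨k, hk⟩, rfl⟩

/-- `X^{2k} ∈ span{X^{2i} : i < m}` for `k < m` (plumbing). [folklore] -/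
private theorem X_pow_mem_evenSpan {k m : ℕ} (h : k < m) :
    (X : ℂ[X]) ^ (2 * k) ∈ Submodule.span ℂ ((fun k : ℕ => (X : ℂ[X]) ^ (2 * k)) '' Set.Iio m) :=
  Submodule.subset_span ⟨k, h, rfl⟩

/-- `span{X^{2i} : i < j} ≤ span{X^{2i} : i < m}` for `j ≤ m` (plumbing). [folklore] -/
private theorem evenSpan_mono {j m : ℕ} (h : j ≤ m) :
    Submodule.span ℂ ((fun k : ℕ => (X : ℂ[X]) ^ (2 * k)) '' Set.Iio j) ≤
      Submodule.span ℂ ((fun k : ℕ => (X : ℂ[X]) ^ (2 * k)) '' Set.Iio m) :=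
  Submodule.span_mono (Set.image_mono (Set.Iio_subset_Iio h))

/-- Triangularity ⇒ equal spans (linear algebra behind "is formed of the even functions `e^{−πx²}P(x)` where `P(x)` is an
even polynomial of degree `≤ 2n`"): if `f j = c_j X^{2j} + (terms in X^{2k}, k < j)` with `c_j ≠ 0` for every `j`, then
`span{f j : j < m} = span{X^{2k} : k < m}`. [cite: ConnesConsaniMoscovici2024, Prop. 3.2 (proof) p. 11 (p0008:L118–L121)] -/
theorem span_eq_evenSpan_of_triangular (f : ℕ → ℂ[X])
    (hf : ∀ j, ∃ c : ℂ, c ≠ 0 ∧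
      f j - c • X ^ (2 * j) ∈ Submodule.span ℂ ((fun k : ℕ => (X : ℂ[X]) ^ (2 * k)) '' Set.Iio j))
    (m : ℕ) :
    Submodule.span ℂ (f '' Set.Iio m) = Submodule.span ℂ ((fun k : ℕ => (X : ℂ[X]) ^ (2 * k)) '' Set.Iio m) := by
  -- each `X^{2j}` lies in `span{f i : i ≤ j}` (strong induction)
  have key : ∀ j, (X : ℂ[X]) ^ (2 * j) ∈ Submodule.span ℂ (f '' Set.Iio (j + 1)) := by
    intro j
    induction j using Nat.strong_induction_on with
    | _ j ih =>
      obtain ⟨c, hc, hr⟩ := hf j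
      have hsub : Submodule.span ℂ ((fun k : ℕ => (X : ℂ[X]) ^ (2 * k)) '' Set.Iio j) ≤
          Submodule.span ℂ (f '' Set.Iio (j + 1)) := by
        refine Submodule.span_le.mpr ?_
        rintro _ ⟨i, hi, rfl⟩
        have hi' : i < j := hi
        exact Submodule.span_mono (Set.image_mono (Set.Iio_subset_Iio (by omega : i + 1 ≤ j + 1))) (ih i hi')
      have hfj : f j ∈ Submodule.span ℂ (f '' Set.Iio (j + 1)) := Submodule.subset_span ⟨j, by simp, rfl⟩
      have : (X : ℂ[X]) ^ (2 * j) = c⁻¹ • (f j - (f j - c • X ^ (2 * j))) := by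
        rw [sub_sub_cancel, smul_smul, inv_mul_cancel₀ hc, one_smul]
      rw [this]
      exact Submodule.smul_mem _ _ (Submodule.sub_mem _ hfj (hsub hr))
  refine Submodule.span_eq_span ?_ ?_
  · rintro _ ⟨j, hj, rfl⟩
    have hj' : j < m := hj
    obtain ⟨c, -, hr⟩ := hf j
    have h1 : c • (X : ℂ[X]) ^ (2 * j) ∈ Submodule.span ℂ ((fun k : ℕ => (X : ℂ[X]) ^ (2 * k)) '' Set.Iio m) :=
      Submodule.smul_mem _ _ (X_pow_mem_evenSpan hj')
    have h2 := Submodule.add_mem _ (evenSpan_mono (le_of_lt hj') hr) h1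
    rwa [sub_add_cancel] at h2
  · rintro _ ⟨j, hj, rfl⟩
    have hj' : j < m := hj
    exact Submodule.span_mono (Set.image_mono (Set.Iio_subset_Iio (by omega : j + 1 ≤ m))) (key j)

/-- The polynomial part of `h_{2j}` is triangular: `H_j − c_{j,j} X^{2j} ∈ span{X^{2k} : k < j}`. [cite: ConnesConsaniMoscovici2024, Prop. 3.2 (ii) eq. (21) p. 11 (p0008:L118)] -/
theorem evenHermitePoly_triangular (j : ℕ) :
    evenHermitePoly j - ((evenHermiteCoeff j j : ℝ) : ℂ) • X ^ (2 * j) ∈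
      Submodule.span ℂ ((fun k : ℕ => (X : ℂ[X]) ^ (2 * k)) '' Set.Iio j) := by
  rw [evenHermitePoly, Finset.sum_range_succ, smul_eq_C_mul, add_sub_cancel_right]
  refine Submodule.sum_mem _ fun k hk => ?_
  rw [← smul_eq_C_mul]
  exact Submodule.smul_mem _ _ (X_pow_mem_evenSpan (Finset.mem_range.mp hk))

/-- "It coincides with the linear span of the functions `h_{2j}`, `0 ≤ j ≤ n`" — on polynomial parts:
`span{H_j : j < m} = span{X^{2k} : k < m}`. [cite: ConnesConsaniMoscovici2024, Prop. 3.2 (proof) p. 11 (p0008:L118–L121)] -/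
theorem span_evenHermitePoly (m : ℕ) :
    Submodule.span ℂ (evenHermitePoly '' Set.Iio m) =
      Submodule.span ℂ ((fun k : ℕ => (X : ℂ[X]) ^ (2 * k)) '' Set.Iio m) :=
  span_eq_evenSpan_of_triangular _ (fun j => ⟨_, by exact_mod_cast evenHermiteCoeff_self_ne_zero j,
    evenHermitePoly_triangular j⟩) m

/-! #### The scaling operator on Gaussian polynomials -/

/-- RH-FREE. The scaling operator `𝕊 = −i(x∂ₓ + ½)` transported to polynomial parts of the Gaussian core, as a `ℂ`-linear
map `P ↦ −i(X(P′ − 2πXP) + P/2)` — the polynomial of `scalingOpFun_gaussPolyFn` (seat t12):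
`𝕊(Pe^{−πx²}) = (scalingPolyOp P)e^{−πx²}`. [cite: ConnesConsaniMoscovici2024, §3.2 p. 10 (p0008:L63); Prop. 3.2 (proof) p. 11 (p0008:L119)] -/
def scalingPolyOp : ℂ[X] →ₗ[ℂ] ℂ[X] where
  toFun P := C (-I) * (X * (derivative P - C (2 * (π : ℂ)) * X * P) + C (1 / 2) * P)
  map_add' P Q := by simp only [derivative_add]; ring
  map_smul' c P := by simp only [smul_eq_C_mul, derivative_C_mul, RingHom.id_apply]; ring

/-- Unfolding `scalingPolyOp` (plumbing). [cite: ConnesConsaniMoscovici2024, §3.2 p. 10 (p0008:L63); Prop. 3.2 (proof) p. 11 (p0008:L119)] -/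
theorem scalingPolyOp_apply (P : ℂ[X]) :
    scalingPolyOp P = C (-I) * (X * (derivative P - C (2 * (π : ℂ)) * X * P) + C (1 / 2) * P) := rfl

/-- `𝕊(Pe^{−πx²}) = (scalingPolyOp P)e^{−πx²}`. [cite: ConnesConsaniMoscovici2024, §3.2 p. 10 (p0008:L63); Prop. 3.2 (proof) p. 11 (p0008:L119)] -/
theorem scalingOpFun_gaussPolyFn' (P : ℂ[X]) : scalingOpFun (gaussPolyFn P) = gaussPolyFn (scalingPolyOp P) :=
  scalingOpFun_gaussPolyFn P

/-- `𝕊ʲ(Pe^{−πx²}) = (scalingPolyOpʲ P)e^{−πx²}` ("the vectors `𝕊ʲξ_∞`"). [cite: ConnesConsaniMoscovici2024, §3.2 p. 10 (p0008:L63); Prop. 3.2 (proof) p. 11 (p0008:L119)] -/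
theorem scalingOpFun_iterate_gaussPolyFn (P : ℂ[X]) (j : ℕ) :
    scalingOpFun^[j] (gaussPolyFn P) = gaussPolyFn (scalingPolyOp^[j] P) := by
  induction j generalizing P with
  | zero => rfl
  | succ j ih => rw [Function.iterate_succ_apply, Function.iterate_succ_apply, scalingOpFun_gaussPolyFn', ih]

/-- `𝕊` raises the even degree by exactly two: `scalingPolyOp X^{2k} = −i(2k + ½) X^{2k} + 2πi X^{2(k+1)}`. [cite: ConnesConsaniMoscovici2024, §3.2 p. 10 (p0008:L63); Prop. 3.2 (proof) p. 11 (p0008:L119)] -/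
theorem scalingPolyOp_X_pow (k : ℕ) :
    scalingPolyOp ((X : ℂ[X]) ^ (2 * k)) =
      C (-I * (2 * k + 1 / 2 : ℂ)) * X ^ (2 * k) + C (2 * π * I : ℂ) * X ^ (2 * (k + 1)) := by
  rw [scalingPolyOp_apply, derivative_X_pow]
  rcases Nat.eq_zero_or_pos k with rfl | hk
  · simp only [mul_zero, pow_zero, Nat.cast_zero, C_0, zero_mul, zero_sub, mul_one, zero_add]
    simp only [map_mul, map_neg]
    ring
  · have hX : (X : ℂ[X]) * X ^ (2 * k - 1) = X ^ (2 * k) := by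
      rw [← pow_succ', show 2 * k - 1 + 1 = 2 * k by omega]
    have e1 : (X : ℂ[X]) * (C ((2 * k : ℕ) : ℂ) * X ^ (2 * k - 1) - C (2 * π : ℂ) * X * X ^ (2 * k)) =
        C ((2 * k : ℕ) : ℂ) * (X * X ^ (2 * k - 1)) - C (2 * π : ℂ) * X ^ (2 * (k + 1)) := by ring
    have c1 : C (-I * (2 * k + 1 / 2 : ℂ)) = C (-I) * (C ((2 * k : ℕ) : ℂ) + C (1 / 2 : ℂ)) := by
      rw [← C_add, ← C_mul]; congr 1; push_cast; ring
    have c2 : C (2 * π * I : ℂ) = -(C (-I) * C (2 * (π : ℂ))) := by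
      rw [← C_mul, ← C_neg]; congr 1; ring
    rw [e1, hX, c1, c2]
    ring

/-- `scalingPolyOp` maps `span{X^{2k} : k < j}` into `span{X^{2k} : k < j+1}` (plumbing). [folklore] -/
private theorem scalingPolyOp_evenSpan_le (j : ℕ) :
    Submodule.span ℂ ((fun k : ℕ => (X : ℂ[X]) ^ (2 * k)) '' Set.Iio j) ≤
      (Submodule.span ℂ ((fun k : ℕ => (X : ℂ[X]) ^ (2 * k)) '' Set.Iio (j + 1))).comap scalingPolyOp := by
  refine Submodule.span_le.mpr ?_
  rintro _ ⟨k, hk, rfl⟩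
  simp only [SetLike.mem_coe, Submodule.mem_comap, scalingPolyOp_X_pow]
  refine Submodule.add_mem _ ?_ ?_
  · rw [← smul_eq_C_mul]; exact Submodule.smul_mem _ _ (X_pow_mem_evenSpan (by simpa using Nat.lt_succ_of_lt hk))
  · rw [← smul_eq_C_mul]; exact Submodule.smul_mem _ _ (X_pow_mem_evenSpan (by simpa using hk))

/-- Triangularity of the scaling iterates: `scalingPolyOpʲ(a) = c_j X^{2j} + (terms in X^{2k}, k < j)` with
`c_j = (2πi)ʲ a ≠ 0` for `a ≠ 0` — "`E_n` … is formed of the even functions `e^{−πx²}P(x)` … of degree `≤ 2n`". [cite: ConnesConsaniMoscovici2024, Prop. 3.2 (proof) p. 11 (p0008:L118–L121)] -/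
theorem scalingPolyOp_iterate_triangular (a : ℂ) (ha : a ≠ 0) (j : ℕ) :
    ∃ c : ℂ, c ≠ 0 ∧ scalingPolyOp^[j] (C a) - c • X ^ (2 * j) ∈
      Submodule.span ℂ ((fun k : ℕ => (X : ℂ[X]) ^ (2 * k)) '' Set.Iio j) := by
  induction j with
  | zero => exact ⟨a, ha, by simp [smul_eq_C_mul]⟩
  | succ j ih =>
    obtain ⟨c, hc, hr⟩ := ih
    refine ⟨2 * π * I * c, mul_ne_zero (mul_ne_zero (mul_ne_zero two_ne_zero (by exact_mod_cast Real.pi_ne_zero))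
      I_ne_zero) hc, ?_⟩
    have hstep := scalingPolyOp_evenSpan_le j hr
    rw [Submodule.mem_comap, map_sub, map_smul, scalingPolyOp_X_pow, smul_add] at hstep
    rw [Function.iterate_succ_apply']
    have hXj : c • (C (-I * (2 * j + 1 / 2 : ℂ)) * (X : ℂ[X]) ^ (2 * j)) ∈
        Submodule.span ℂ ((fun k : ℕ => (X : ℂ[X]) ^ (2 * k)) '' Set.Iio (j + 1)) := by
      rw [← smul_eq_C_mul, smul_smul]
      exact Submodule.smul_mem _ _ (X_pow_mem_evenSpan (Nat.lt_succ_self j))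
    have := Submodule.add_mem _ hstep hXj
    convert this using 1
    rw [smul_eq_C_mul, smul_eq_C_mul, smul_eq_C_mul, map_mul]
    ring

/-- On polynomial parts: `span{scalingPolyOpʲ(a) : j < m} = span{X^{2k} : k < m}` (`a ≠ 0`). [cite: ConnesConsaniMoscovici2024, Prop. 3.2 (proof) p. 11 (p0008:L118–L121)] -/
theorem span_scalingPolyOp_iterate (a : ℂ) (ha : a ≠ 0) (m : ℕ) :
    Submodule.span ℂ ((fun j : ℕ => scalingPolyOp^[j] (C a)) '' Set.Iio m) =
      Submodule.span ℂ ((fun k : ℕ => (X : ℂ[X]) ^ (2 * k)) '' Set.Iio m) :=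
  span_eq_evenSpan_of_triangular _ (scalingPolyOp_iterate_triangular a ha) m

/-! #### Transport to functions and the discharge -/

/-- `ξ_∞ = h_0 = 2^{1/4}e^{−πx²}` as an element of the Gaussian core (constant polynomial part `2^{1/4}`).
[cite: ConnesConsaniMoscovici2024, §3.2 p. 10 (p0008:L72); Prop. 3.2 (proof) p. 11 (p0008:L119)] -/
theorem toC_hermiteH0 : toC hermiteH0 = gaussPolyFn (C ((((2 : ℝ) ^ (1 / 4 : ℝ) : ℝ) : ℂ))) := by
  funext x
  simp only [toC, hermiteH0, gaussPolyFn, eval_C]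
  push_cast
  ring

/-- RH-FREE. The `ℂ`-linear map `P ↦ P(x)e^{−πx²}` from polynomial parts onto the Gaussian core (`gaussPolyFn` bundled;
used to transport span identities from `ℂ[X]` to functions). [cite: ConnesConsaniMoscovici2024, Prop. 3.2 (proof) p. 11 (p0008:L118–L121)] -/
def gaussPolyLin : ℂ[X] →ₗ[ℂ] (ℝ → ℂ) where
  toFun := gaussPolyFn
  map_add' P Q := by funext x; simp only [gaussPolyFn, eval_add, Pi.add_apply]; ring
  map_smul' c P := by funext x; simp only [gaussPolyFn, eval_smul, smul_eq_mul, Pi.smul_apply, RingHom.id_apply]; ring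

/-- `span{F(j)e^{−πx²} : j < m} = gaussPolyLin(span{F j : j < m})` (plumbing). [folklore] -/
private theorem span_range_fin_gaussPolyFn (F : ℕ → ℂ[X]) (m : ℕ) :
    Submodule.span ℂ (Set.range fun j : Fin m => gaussPolyFn (F j)) =
      (Submodule.span ℂ (F '' Set.Iio m)).map gaussPolyLin := by
  rw [← Submodule.span_image]
  congr 1
  ext f
  constructor
  · rintro ⟨j, rfl⟩; exact ⟨F j, ⟨j, j.2, rfl⟩, rfl⟩
  · rintro ⟨_, ⟨j, hj, rfl⟩, rfl⟩; exact ⟨⟨j, hj⟩, rfl⟩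

/-- **Proposition 3.2, first span identity (PROVED)**: `E_n = span{𝕊ʲξ_∞ : j ≤ n} = span{x^{2k}e^{−πx²} : k ≤ n}`. [cite: ConnesConsaniMoscovici2024, Prop. 3.2 p. 11 (p0008:L107–L121)] -/
theorem span_scalingOpFun_iterate_hermiteH0 (n : ℕ) :
    Submodule.span ℂ (Set.range fun j : Fin (n + 1) => scalingOpFun^[j] (toC hermiteH0)) =
      Submodule.span ℂ (Set.range fun k : Fin (n + 1) => gaussPolyFn (X ^ (2 * (k : ℕ)))) := by
  have h0 : ((((2 : ℝ) ^ (1 / 4 : ℝ) : ℝ) : ℂ)) ≠ 0 := by exact_mod_cast (Real.rpow_pos_of_pos two_pos _).ne'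
  have hfun : (fun j : Fin (n + 1) => scalingOpFun^[j] (toC hermiteH0)) =
      fun j : Fin (n + 1) => gaussPolyFn ((fun i : ℕ => scalingPolyOp^[i] (C ((((2 : ℝ) ^ (1 / 4 : ℝ) : ℝ) : ℂ)))) j) := by
    funext j
    rw [toC_hermiteH0, scalingOpFun_iterate_gaussPolyFn]
  rw [hfun, span_range_fin_gaussPolyFn (fun i : ℕ => scalingPolyOp^[i] (C ((((2 : ℝ) ^ (1 / 4 : ℝ) : ℝ) : ℂ)))) (n + 1),
    span_range_fin_gaussPolyFn (fun k : ℕ => (X : ℂ[X]) ^ (2 * k)) (n + 1), span_scalingPolyOp_iterate _ h0]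

/-- **Proposition 3.2, second span identity (PROVED)**: `span{x^{2k}e^{−πx²} : k ≤ n} = span{h_{2j} : j ≤ n}`. [cite: ConnesConsaniMoscovici2024, Prop. 3.2 p. 11 (p0008:L107–L121)] -/
theorem span_gaussPolyFn_eq_span_evenHermiteFn (n : ℕ) :
    Submodule.span ℂ (Set.range fun k : Fin (n + 1) => gaussPolyFn (X ^ (2 * (k : ℕ)))) =
      Submodule.span ℂ (Set.range fun j : Fin (n + 1) => toC (evenHermiteFn j)) := by
  have hfun : (fun j : Fin (n + 1) => toC (evenHermiteFn j)) =
      fun j : Fin (n + 1) => gaussPolyFn (evenHermitePoly j) := by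
    funext j
    rw [toC_evenHermiteFn]
  rw [hfun, span_range_fin_gaussPolyFn evenHermitePoly (n + 1),
    span_range_fin_gaussPolyFn (fun k : ℕ => (X : ℂ[X]) ^ (2 * k)) (n + 1), span_evenHermitePoly]

/-- **Discharge of the named fact `CCM2024_prop_3_2`** (Proposition 3.2 as typed in `ProlateWaveCyclicPairs.lean` by seat
t12: the eigen-equation `𝐇 h_{2n} = 2π(4n+1)h_{2n}` and the two span identities for `E_n`). [cite: ConnesConsaniMoscovici2024, Prop. 3.2 p. 11 (p0008:L107–L121)] -/
theorem CCM2024_prop_3_2_holds : CCM2024_prop_3_2 :=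
  ⟨hermiteOpFun_evenHermiteFn, fun n =>
    ⟨span_scalingOpFun_iterate_hermiteH0 n, span_gaussPolyFn_eq_span_evenHermiteFn n⟩⟩

/-- **Discharge of the named fact `CCM2024_cor_3_2`** (Corollary 3.2 = Theorem 3.1 (v), eq. (22):
`𝒰(W_λ h_{2n})(s) = (−s² + 2πλ²(4n+1) − ¼)𝒰(h_{2n})(s)`), by seat t12's PROVED reduction
`CCM2024_cor_3_2_of_prop_3_2` (`W_λ = −𝕊² − ¼ + λ²𝐇` on the Gaussian core, Thm. 3.1 (iv) twice, and Prop. 3.2 (i))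
fed with `CCM2024_prop_3_2_holds`. [cite: ConnesConsaniMoscovici2024, Cor. 3.2 eq. (22) p. 11 (p0009:L1); Thm. 3.1 (v) eq. (14) p. 9] -/
theorem CCM2024_cor_3_2_holds : CCM2024_cor_3_2 :=
  CCM2024_cor_3_2_of_prop_3_2 CCM2024_prop_3_2_holds

end Prop32

/-! ## Part 3 — eq. (21) versus `Polynomial.hermite` -/

section Eq21

open Polynomial Literature.Probability.Distributions

/-- Splitting a sum over `range (2n+1)` into even and odd indices (plumbing). [folklore] -/
private theorem sum_range_even_odd_split (f : ℕ → ℝ) (n : ℕ) :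
    ∑ i ∈ range (2 * n + 1), f i = ∑ k ∈ range (n + 1), f (2 * k) + ∑ k ∈ range n, f (2 * k + 1) := by
  induction n with
  | zero => simp
  | succ n ih =>
    rw [show 2 * (n + 1) + 1 = 2 * n + 1 + 1 + 1 by ring, sum_range_succ, sum_range_succ, ih,
      sum_range_succ (fun k => f (2 * k)) (n + 1), sum_range_succ (fun k => f (2 * k + 1)) n,
      show 2 * n + 1 + 1 = 2 * (n + 1) by ring, show 2 * n + 1 = 2 * n + 1 from rfl]
    ring

/-- Odd coefficients of `He_{2n}` vanish (Mathlib `coeff_hermite_of_odd_add`; plumbing). [folklore] -/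
private theorem hermiteR_two_mul_coeff_odd (n k : ℕ) : (hermiteR (2 * n)).coeff (2 * k + 1) = 0 := by
  rw [hermiteR, coeff_map, coeff_hermite_of_odd_add ⟨n + k, by ring⟩, map_zero]

/-- Even coefficients of `He_{2(k+m)}`: `(−1)^m (2m−1)!! binom(2(k+m), 2k)` (Mathlib `coeff_hermite_explicit`; plumbing).
[folklore] -/
private theorem hermiteR_two_mul_coeff_even (k m : ℕ) :
    (hermiteR (2 * (k + m))).coeff (2 * k) =
      (-1 : ℝ) ^ m * ((2 * m - 1)‼ : ℝ) * ((2 * (k + m)).choose (2 * k) : ℝ) := by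
  rw [hermiteR, coeff_map, show 2 * (k + m) = 2 * m + 2 * k by ring, coeff_hermite_explicit, eq_intCast]
  push_cast
  ring

/-- `He_{2n}(y) = Σ_{k ≤ n} coeff_{2k}(He_{2n}) y^{2k}` (plumbing). [folklore] -/
private theorem hermiteR_two_mul_eval (n : ℕ) (y : ℝ) :
    (hermiteR (2 * n)).eval y = ∑ k ∈ range (n + 1), (hermiteR (2 * n)).coeff (2 * k) * y ^ (2 * k) := by
  rw [eval_eq_sum_range, natDegree_hermiteR, sum_range_even_odd_split]
  simp [hermiteR_two_mul_coeff_odd]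

/-- The factorial bookkeeping `2^{3k}(2n)! = (2m−1)!!·binom(2n,2k)·4ᵏ·(2k)!·m!·2ⁿ`, `n = k + m` (plumbing). [folklore] -/
private theorem two_pow_mul_factorial_eq (k m : ℕ) :
    2 ^ (3 * k) * (2 * (k + m))! = (2 * m - 1)‼ * (2 * (k + m)).choose (2 * k) * 4 ^ k * ((2 * k)! * m !) * 2 ^ (k + m) := by
  have h1 : (2 * (k + m)).choose (2 * k) * (2 * k)! * (2 * m)! = (2 * (k + m))! := by
    have := Nat.choose_mul_factorial_mul_factorial (show 2 * k ≤ 2 * (k + m) by omega)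
    rwa [show 2 * (k + m) - 2 * k = 2 * m by omega] at this
  have h2 : (2 * m)! = 2 ^ m * m ! * (2 * m - 1)‼ := by
    rcases m with _ | m
    · simp
    · rw [show 2 * (m + 1) = 2 * m + 1 + 1 by ring, Nat.factorial_eq_mul_doubleFactorial,
        show 2 * m + 1 + 1 = 2 * (m + 1) by ring, Nat.doubleFactorial_two_mul,
        show 2 * (m + 1) - 1 = 2 * m + 1 by omega]
  rw [← h1, h2, show (4 : ℕ) = 2 ^ 2 from rfl, ← pow_mul, pow_add]
  ring

/-- The scalar identity `2^{3k−n}((2n)!)^{1/2}/((2k)!m!) = (2m−1)!!·binom(2n,2k)·4ᵏ/((2n)!)^{1/2}`, `n = k + m`, matching the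
coefficients of (21) with those of `He_{2n}(2√π x)` (plumbing). [folklore] -/
private theorem evenHermite_scalar_identity (k m : ℕ) :
    (2 : ℝ) ^ (3 * k) / 2 ^ (k + m) * Real.sqrt ((2 * (k + m))! : ℝ) / (((2 * k)! : ℝ) * (m ! : ℝ)) =
      ((2 * m - 1)‼ : ℝ) * ((2 * (k + m)).choose (2 * k) : ℝ) * 4 ^ k / Real.sqrt ((2 * (k + m))! : ℝ) := by
  have hN : (0 : ℝ) < ((2 * (k + m))! : ℝ) := by positivity
  have hs : Real.sqrt ((2 * (k + m))! : ℝ) ≠ 0 := (Real.sqrt_pos.mpr hN).ne'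
  have hd : (((2 * k)! : ℝ) * (m ! : ℝ)) ≠ 0 := by positivity
  rw [div_eq_div_iff hd hs, mul_assoc, Real.mul_self_sqrt hN.le, div_mul_eq_mul_div,
    div_eq_iff (by positivity : (2 : ℝ) ^ (k + m) ≠ 0)]
  exact_mod_cast congrArg (Nat.cast : ℕ → ℝ) (two_pow_mul_factorial_eq k m)

/-- **Eq. (21) versus `Polynomial.hermite` (PROVED)**: `h_{2n}(x) = 2^{1/4}((2n)!)^{−1/2} He_{2n}(2√π x) e^{−πx²}` with the
tree's `hermiteR = (Polynomial.hermite _).map ℤ→ℝ` — "`h_n(x) = H_n(x)h_0(x)` where the `H_n` are orthogonal (and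
normalized) polynomials". [cite: ConnesConsaniMoscovici2024, Thm. 3.1 p. 10 (p0008:L23); Prop. 3.2 (ii) eq. (21) p. 11 (p0008:L118)] -/
theorem evenHermiteFn_eq_hermiteR (n : ℕ) (x : ℝ) :
    evenHermiteFn n x =
      (2 : ℝ) ^ (1 / 4 : ℝ) / Real.sqrt ((2 * n)! : ℝ) * (hermiteR (2 * n)).eval (2 * Real.sqrt π * x) *
        Real.exp (-π * x ^ 2) := by
  rw [hermiteR_two_mul_eval, evenHermiteFn, Finset.mul_sum, Finset.sum_mul]
  refine Finset.sum_congr rfl fun k hk => ?_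
  obtain ⟨m, rfl⟩ := Nat.exists_eq_add_of_le (Nat.lt_succ_iff.mp (Finset.mem_range.mp hk))
  rw [hermiteR_two_mul_coeff_even, Nat.add_sub_cancel_left]
  have hsq : Real.sqrt π ^ 2 = π := Real.sq_sqrt Real.pi_pos.le
  have hpow : (2 * Real.sqrt π * x) ^ (2 * k) = 4 ^ k * π ^ k * x ^ (2 * k) := by
    rw [pow_mul, show (2 * Real.sqrt π * x) ^ 2 = 4 * π * x ^ 2 by rw [mul_pow, mul_pow, hsq]; ring,
      mul_pow, mul_pow, ← pow_mul]
  have hL : (-1 : ℝ) ^ m * ((2 : ℝ) ^ (1 / 4 : ℝ) * 2 ^ (3 * k) / 2 ^ (k + m)) * Real.sqrt ((2 * (k + m))! : ℝ) /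
        (((2 * k)! : ℝ) * (m ! : ℝ)) * π ^ k * x ^ (2 * k) * Real.exp (-π * x ^ 2) =
      (-1 : ℝ) ^ m * (2 : ℝ) ^ (1 / 4 : ℝ) *
        ((2 : ℝ) ^ (3 * k) / 2 ^ (k + m) * Real.sqrt ((2 * (k + m))! : ℝ) / (((2 * k)! : ℝ) * (m ! : ℝ))) *
        (π ^ k * x ^ (2 * k) * Real.exp (-π * x ^ 2)) := by ring
  rw [hL, evenHermite_scalar_identity, hpow]
  ring

/-- **Discharge of the named fact `CCM2024_eq_21`** (the dictionary eq. (21) ↔ `Polynomial.hermite`, typed in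
`ProlateWaveCyclicPairs.lean` by seat t12). [cite: ConnesConsaniMoscovici2024, Thm. 3.1 p. 10 (p0008:L23); Prop. 3.2 (ii) eq. (21) p. 11 (p0008:L118)] -/
theorem CCM2024_eq_21_holds : CCM2024_eq_21 := evenHermiteFn_eq_hermiteR

end Eq21

/-! ## Part 4 — Proposition 3.4: `1 ≤ a_n log(1 + 1/n) ≤ √3 log 2` and the metric equivalence -/

section Prop34

open Literature.Analysis.SpecialFunctions.Real (two_div_le_log_one_add_inv log_one_add_inv_le)


/-- `a_n² = (n+½)(n+1)` for `a_n = √((n+½)(n+1))` ("The sequence `(a_n)` … is given by `a_n = √((n+½)(n+1))`"). [cite: ConnesConsaniMoscovici2024, Prop. 3.4 (proof) p. 13 (p0009:L98)] -/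
theorem scalingJacobiA_sq (n : ℕ) : scalingJacobiA n ^ 2 = (n + 1 / 2) * (n + 1) :=
  Real.sq_sqrt (by positivity)

/-- `a_n > 0`. [cite: ConnesConsaniMoscovici2024, Prop. 3.4 (proof) p. 13 (p0009:L98)] -/
theorem scalingJacobiA_pos (n : ℕ) : 0 < scalingJacobiA n := Real.sqrt_pos.mpr (by positivity)

/-- **Prop. 3.4, displayed inequality, lower half (PROVED)**: `1 ≤ a_n log(1 + 1/n)` for `n ≥ 1` — from
`log(1 + 1/n) ≥ 2/(2n+1)` (tree: `two_div_le_log_one_add_inv`, first term of Mathlib's `Real.hasSum_log_one_add_inv`)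
and `a_n ≥ n + ½`. [cite: ConnesConsaniMoscovici2024, Prop. 3.4 p. 13 (p0009:L96–L104)] -/
theorem one_le_scalingJacobiA_mul_log {n : ℕ} (hn : 1 ≤ n) : 1 ≤ scalingJacobiA n * Real.log (1 + 1 / n) := by
  have hn' : (0 : ℝ) < n := by exact_mod_cast hn
  have hlog := two_div_le_log_one_add_inv hn'
  rw [← one_div] at hlog
  have ha : (n : ℝ) + 1 / 2 ≤ scalingJacobiA n := by
    rw [scalingJacobiA, Real.le_sqrt (by positivity) (by positivity)]
    nlinarith
  have hlogpos : 0 < 2 / (2 * (n : ℝ) + 1) := by positivity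
  calc (1 : ℝ) = ((n : ℝ) + 1 / 2) * (2 / (2 * n + 1)) := by field_simp
    _ ≤ scalingJacobiA n * Real.log (1 + 1 / n) :=
        mul_le_mul ha hlog hlogpos.le (scalingJacobiA_pos n).le

/-- `6/5 ≤ √3 log 2` (numerics: `√3 ≥ 1.732`, Mathlib `Real.log_two_gt_d9`; plumbing). [folklore] -/
private theorem six_fifths_le_sqrt_three_mul_log_two : (6 / 5 : ℝ) ≤ Real.sqrt 3 * Real.log 2 := by
  have h3 : (1.732 : ℝ) ≤ Real.sqrt 3 := by
    rw [Real.le_sqrt (by norm_num) (by norm_num)]; norm_num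
  have h2 := Real.log_two_gt_d9
  nlinarith

/-- **Prop. 3.4, displayed inequality, upper half (PROVED)**: `a_n log(1 + 1/n) ≤ √3 log 2` for `n ≥ 1` — equality at
`n = 1` (`a_1 = √3`); for `n ≥ 2` from `log(1 + 1/n) ≤ (2n+1)/(2n(n+1))` (tree: `log_one_add_inv_le`, geometric majorant of
Mathlib's series) and `a_n(2n+1)/(2n(n+1)) ≤ 6/5 ≤ √3 log 2` (`25(2n+1)³ ≤ 288n²(n+1)`). [cite: ConnesConsaniMoscovici2024, Prop. 3.4 p. 13 (p0009:L96–L104)] -/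
theorem scalingJacobiA_mul_log_le {n : ℕ} (hn : 1 ≤ n) :
    scalingJacobiA n * Real.log (1 + 1 / n) ≤ Real.sqrt 3 * Real.log 2 := by
  rcases Nat.eq_or_lt_of_le hn with h1 | h2
  · -- n = 1: a_1 = √3 and log(1 + 1) = log 2
    subst h1
    have : scalingJacobiA 1 = Real.sqrt 3 := by rw [scalingJacobiA]; norm_num
    rw [this]; norm_num
  · -- n ≥ 2
    have hn' : (0 : ℝ) < n := by exact_mod_cast (by omega : 0 < n)
    have hn2 : (2 : ℝ) ≤ n := by exact_mod_cast h2
    have hlog := log_one_add_inv_le hn'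
    rw [← one_div] at hlog
    have hlog0 : 0 ≤ Real.log (1 + 1 / (n : ℝ)) := Real.log_nonneg (by
      have : (0:ℝ) ≤ 1 / n := by positivity
      linarith)
    -- a_n ≤ (6/5) · 2n(n+1)/(2n+1)
    have ha : scalingJacobiA n ≤ 6 / 5 * (2 * n * (n + 1) / (2 * n + 1)) := by
      rw [scalingJacobiA, Real.sqrt_le_left (by positivity)]
      have h2n : (2 * (n : ℝ) + 1) ≠ 0 := by positivity
      have key : 25 * (2 * (n : ℝ) + 1) ^ 3 ≤ 288 * n ^ 2 * (n + 1) := by nlinarith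
      rw [show (6 / 5 * (2 * n * (n + 1) / (2 * n + 1)) : ℝ) ^ 2 = 144 * n ^ 2 * (n + 1) ^ 2 / (25 * (2 * n + 1) ^ 2) by
        field_simp; ring, le_div_iff₀ (by positivity)]
      nlinarith [mul_nonneg (sub_nonneg.mpr key) (by positivity : (0 : ℝ) ≤ n + 1)]
    calc scalingJacobiA n * Real.log (1 + 1 / n)
        ≤ (6 / 5 * (2 * n * (n + 1) / (2 * n + 1))) * ((2 * n + 1) / (2 * n * (n + 1))) :=
          mul_le_mul ha hlog hlog0 (by positivity)
      _ = 6 / 5 := by field_simp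
      _ ≤ Real.sqrt 3 * Real.log 2 := six_fifths_le_sqrt_three_mul_log_two

/-- The displayed inequality divided by `a_j > 0`: `1/a_j ≤ log(1 + 1/j) ≤ √3 log 2 · (1/a_j)` (`j ≥ 1`). [cite: ConnesConsaniMoscovici2024, Prop. 3.4 p. 13 (p0009:L96–L104)] -/
theorem inv_scalingJacobiA_le_log {j : ℕ} (hj : 1 ≤ j) :
    (scalingJacobiA j)⁻¹ ≤ Real.log (1 + 1 / j) ∧
      Real.log (1 + 1 / j) ≤ Real.sqrt 3 * Real.log 2 * (scalingJacobiA j)⁻¹ := by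
  have ha := scalingJacobiA_pos j
  constructor
  · rw [inv_le_iff_one_le_mul₀ ha, mul_comm]
    exact one_le_scalingJacobiA_mul_log hj
  · rw [← div_eq_mul_inv, le_div_iff₀ ha, mul_comm]
    exact scalingJacobiA_mul_log_le hj

/-- `φ(n+1) = φ(n) + 1/a_{n+1}` for the spectral-distance function `φ(n) = Σ_{j ≤ n} a_j⁻¹` of eq. (11). [cite: ConnesConsaniMoscovici2024, Prop. 2.3 eq. (11) p. 8 (p0007:L52); Prop. 3.4 p. 13 (p0009:L102)] -/
theorem spectralPhi_scalingJacobiA_succ (n : ℕ) :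
    spectralPhi (fun j => (scalingJacobiA j : ℂ)) (n + 1) =
      spectralPhi (fun j => (scalingJacobiA j : ℂ)) n + (scalingJacobiA (n + 1))⁻¹ := by
  rw [spectralPhi, spectralPhi, Finset.sum_range_succ, Complex.norm_real, Real.norm_eq_abs,
    abs_of_pos (scalingJacobiA_pos _)]

/-- `log(n+2) − log(n+1) = log(1 + 1/(n+1))` (plumbing). [folklore] -/
private theorem log_succ_succ_sub (n : ℕ) :
    Real.log ((n : ℝ) + 1 + 1) - Real.log ((n : ℝ) + 1) = Real.log (1 + 1 / ((n : ℝ) + 1)) := by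
  have h1 : (n : ℝ) + 1 ≠ 0 := by positivity
  rw [← Real.log_div (by positivity) h1]
  congr 1
  field_simp

/-- Telescoped comparison ("which shows that the metric induced on `ℕ* ⊂ ℝ₊*` … is equivalent to the metric
`d(n,m) := |φ(n) − φ(m)|`"): for `n = m + d`, `0 ≤ φ(n) − φ(m) ≤ log(n+1) − log(m+1) ≤ √3 log 2 (φ(n) − φ(m))`,
summing `inv_scalingJacobiA_le_log` over `m < j ≤ n`. [cite: ConnesConsaniMoscovici2024, Prop. 3.4 p. 13 (p0009:L96–L104)] -/
theorem spectralPhi_sub_bounds (m d : ℕ) :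
    0 ≤ spectralPhi (fun j => (scalingJacobiA j : ℂ)) (m + d) - spectralPhi (fun j => (scalingJacobiA j : ℂ)) m ∧
    spectralPhi (fun j => (scalingJacobiA j : ℂ)) (m + d) - spectralPhi (fun j => (scalingJacobiA j : ℂ)) m ≤
        Real.log (((m + d : ℕ) : ℝ) + 1) - Real.log ((m : ℝ) + 1) ∧
      Real.log (((m + d : ℕ) : ℝ) + 1) - Real.log ((m : ℝ) + 1) ≤ Real.sqrt 3 * Real.log 2 *
        (spectralPhi (fun j => (scalingJacobiA j : ℂ)) (m + d) - spectralPhi (fun j => (scalingJacobiA j : ℂ)) m) := by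
  induction d with
  | zero => simp
  | succ d ih =>
    obtain ⟨h0, h1, h2⟩ := ih
    obtain ⟨hl, hu⟩ := inv_scalingJacobiA_le_log (show 1 ≤ m + d + 1 by omega)
    have hstep : Real.log (((m + d + 1 : ℕ) : ℝ) + 1) =
        Real.log (((m + d : ℕ) : ℝ) + 1) + Real.log (1 + 1 / ((m + d + 1 : ℕ) : ℝ)) := by
      rw [← sub_eq_iff_eq_add', show (((m + d + 1 : ℕ) : ℝ)) = ((m + d : ℕ) : ℝ) + 1 by push_cast; ring,
        log_succ_succ_sub]
    rw [show m + (d + 1) = m + d + 1 by ring, spectralPhi_scalingJacobiA_succ, hstep]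
    have hapos := (scalingJacobiA_pos (m + d + 1)).le
    have hinv : 0 ≤ (scalingJacobiA (m + d + 1))⁻¹ := inv_nonneg.mpr hapos
    refine ⟨by linarith, by linarith, ?_⟩
    have : Real.sqrt 3 * Real.log 2 *
        (spectralPhi (fun j => (scalingJacobiA j : ℂ)) (m + d) + (scalingJacobiA (m + d + 1))⁻¹ -
          spectralPhi (fun j => (scalingJacobiA j : ℂ)) m) =
        Real.sqrt 3 * Real.log 2 *
          (spectralPhi (fun j => (scalingJacobiA j : ℂ)) (m + d) - spectralPhi (fun j => (scalingJacobiA j : ℂ)) m) +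
          Real.sqrt 3 * Real.log 2 * (scalingJacobiA (m + d + 1))⁻¹ := by
      ring
    rw [this]
    linarith

/-- **Prop. 3.4, metric equivalence (PROVED)**: `|φ(n) − φ(m)| ≤ |log(n+1) − log(m+1)| ≤ √3 log 2 · |φ(n) − φ(m)|`
(the invariant metric of `ℝ₊*` on `ℕ* = {n+1}` versus `d(n,m) = |φ(n) − φ(m)|`). [cite: ConnesConsaniMoscovici2024, Prop. 3.4 p. 13 (p0009:L96–L104)] -/
theorem spectralPhi_abs_sub_bounds (n m : ℕ) :
    |spectralPhi (fun j => (scalingJacobiA j : ℂ)) n - spectralPhi (fun j => (scalingJacobiA j : ℂ)) m|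
        ≤ |Real.log (n + 1) - Real.log (m + 1)| ∧
      |Real.log (n + 1) - Real.log (m + 1)| ≤ Real.sqrt 3 * Real.log 2 *
        |spectralPhi (fun j => (scalingJacobiA j : ℂ)) n - spectralPhi (fun j => (scalingJacobiA j : ℂ)) m| := by
  rcases le_total m n with h | h
  · obtain ⟨d, rfl⟩ := Nat.exists_eq_add_of_le h
    obtain ⟨h0, h1, h2⟩ := spectralPhi_sub_bounds m d
    rw [abs_of_nonneg h0, abs_of_nonneg (h0.trans h1)]
    exact ⟨h1, h2⟩
  · obtain ⟨d, rfl⟩ := Nat.exists_eq_add_of_le h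
    obtain ⟨h0, h1, h2⟩ := spectralPhi_sub_bounds n d
    rw [abs_sub_comm, abs_of_nonneg h0, abs_sub_comm (Real.log _), abs_of_nonneg (h0.trans h1)]
    exact ⟨h1, h2⟩

/-- **Discharge of the named fact `CCM2024_prop_3_4`** (Proposition 3.4, quantitative form as typed in
`ProlateWaveCyclicPairs.lean` by seat t12). [cite: ConnesConsaniMoscovici2024, Prop. 3.4 p. 13 (p0009:L96–L104)] -/
theorem CCM2024_prop_3_4_holds : CCM2024_prop_3_4 :=
  ⟨fun _ hn => ⟨one_le_scalingJacobiA_mul_log hn, scalingJacobiA_mul_log_le hn⟩, spectralPhi_abs_sub_bounds⟩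

end Prop34

/-! ## Part 5 — eq. (25): `⟨(H + ½)h_{2n}, h_{2n+2}⟩ = −½√((2n+1)(2n+2))` -/

section Eq25

open Polynomial MeasureTheory ProbabilityTheory Literature.Probability.Distributions

/-- `He_{m+1}' = (m+1) He_m` with the factor as a cast natural (plumbing). [folklore] -/
private theorem derivative_hermiteR_succ' (m : ℕ) :
    derivative (hermiteR (m + 1)) = ((m + 1 : ℕ) : ℝ[X]) * hermiteR m := by
  rw [derivative_hermiteR_succ, map_add, map_natCast, map_one, Nat.cast_add, Nat.cast_one]

/-- The "highest term" computation of the proof of (25), in Hermite-polynomial coordinates `y = 2√π x`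
(`H = x∂ₓ = y∂_y`, `2πx² = y²/2`): `2X He_{2n}' − X² He_{2n} + He_{2n} = −He_{2n+2} + 2n(2n−1) He_{2n−2}`, i.e.
`(H + ½)h_{2n} = −½√((2n+1)(2n+2)) h_{2n+2} + (multiple of h_{2n−2})` — from the three-term recurrence
`He_{m+1} = X He_m − He_m'`, `He_{m+1}' = (m+1)He_m` (tree `hermiteR_succ`, `derivative_hermiteR_succ`). [cite: ConnesConsaniMoscovici2024, Prop. 3.3 (proof) eq. (25) p. 12 (p0009:L44–L59)] -/
theorem hermiteR_scaling_identity (n : ℕ) :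
    2 * X * derivative (hermiteR (2 * n)) - X ^ 2 * hermiteR (2 * n) + hermiteR (2 * n) =
      -hermiteR (2 * n + 2) + ((2 * n * (2 * n - 1) : ℕ) : ℝ[X]) * hermiteR (2 * n - 2) := by
  rcases n with _ | k
  · simp [hermiteR_succ, show (2 : ℕ) = 0 + 1 + 1 from rfl]
    ring
  · have e0 : 2 * (k + 1) = 2 * k + 1 + 1 := by ring
    have e2 : 2 * k + 1 + 1 + 2 = 2 * k + 1 + 1 + 1 + 1 := by ring
    have e1 : 2 * k + 1 + 1 - 2 = 2 * k := by omega
    have e3 : (2 * k + 1 + 1) * (2 * k + 1 + 1 - 1) = (2 * k + 2) * (2 * k + 1) := by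
      rw [show 2 * k + 1 + 1 - 1 = 2 * k + 1 by omega]
    rw [e0, e2, e1, e3]
    -- express everything through `A = He_{2k}`, `B = He_{2k+1}`
    have h2 : hermiteR (2 * k + 1 + 1) = X * hermiteR (2 * k + 1) - ((2 * k + 1 : ℕ) : ℝ[X]) * hermiteR (2 * k) := by
      rw [hermiteR_succ, derivative_hermiteR_succ']
    have h2' : derivative (hermiteR (2 * k + 1 + 1)) = ((2 * k + 1 + 1 : ℕ) : ℝ[X]) * hermiteR (2 * k + 1) :=
      derivative_hermiteR_succ' _
    have h3 : hermiteR (2 * k + 1 + 1 + 1) = X * hermiteR (2 * k + 1 + 1) - derivative (hermiteR (2 * k + 1 + 1)) :=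
      hermiteR_succ _
    have h3' : derivative (hermiteR (2 * k + 1 + 1 + 1)) = ((2 * k + 1 + 1 + 1 : ℕ) : ℝ[X]) * hermiteR (2 * k + 1 + 1) :=
      derivative_hermiteR_succ' _
    have h4 : hermiteR (2 * k + 1 + 1 + 1 + 1) =
        X * hermiteR (2 * k + 1 + 1 + 1) - derivative (hermiteR (2 * k + 1 + 1 + 1)) := hermiteR_succ _
    rw [h4, h3', h3, h2', h2]
    push_cast
    ring

/-- `h_{2n}' = 2^{1/4}((2n)!)^{−1/2}(2√π He_{2n}'(2√πx) − 2πx He_{2n}(2√πx))e^{−πx²}`, differentiating the PROVED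
eq. (21) (`evenHermiteFn_eq_hermiteR`). [cite: ConnesConsaniMoscovici2024, Prop. 3.2 (ii) eq. (21) p. 11 (p0008:L118); Prop. 3.3 (proof) p. 12 (p0009:L44)] -/
theorem hasDerivAt_evenHermiteFn (n : ℕ) (x : ℝ) :
    HasDerivAt (evenHermiteFn n)
      ((2 : ℝ) ^ (1 / 4 : ℝ) / Real.sqrt ((2 * n)! : ℝ) *
        ((derivative (hermiteR (2 * n))).eval (2 * Real.sqrt π * x) * (2 * Real.sqrt π) * Real.exp (-π * x ^ 2) +
          (hermiteR (2 * n)).eval (2 * Real.sqrt π * x) * (Real.exp (-π * x ^ 2) * (-π * (2 * x))))) x := by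
  have hfun : evenHermiteFn n = fun y => (2 : ℝ) ^ (1 / 4 : ℝ) / Real.sqrt ((2 * n)! : ℝ) *
      ((hermiteR (2 * n)).eval (2 * Real.sqrt π * y) * Real.exp (-π * y ^ 2)) := by
    funext y; rw [evenHermiteFn_eq_hermiteR n y]; ring
  rw [hfun]
  have hg : HasDerivAt (fun y : ℝ => 2 * Real.sqrt π * y) (2 * Real.sqrt π) x := by
    simpa using (hasDerivAt_id x).const_mul (2 * Real.sqrt π)
  have hh : HasDerivAt (fun y : ℝ => (hermiteR (2 * n)).eval (2 * Real.sqrt π * y))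
      ((derivative (hermiteR (2 * n))).eval (2 * Real.sqrt π * x) * (2 * Real.sqrt π)) x :=
    (Polynomial.hasDerivAt (hermiteR (2 * n)) (2 * Real.sqrt π * x)).comp x hg
  have he : HasDerivAt (fun y : ℝ => Real.exp (-π * y ^ 2)) (Real.exp (-π * x ^ 2) * (-π * (↑2 * x ^ (2 - 1)))) x :=
    (Real.hasDerivAt_exp _).comp x ((hasDerivAt_pow 2 x).const_mul (-π))
  have := (hh.mul he).const_mul ((2 : ℝ) ^ (1 / 4 : ℝ) / Real.sqrt ((2 * n)! : ℝ))
  refine this.congr_deriv ?_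
  simp only [pow_one, Nat.add_one_sub_one]

/-- The integrand of eq. (25) after `y = 2√π x`: `(xh_{2n}' + h_{2n}/2)h_{2n+2} = (c_n c_{n+1}/2) Φ_n(2√πx)` with
`Φ_n(y) = ((2XHe_{2n}' − X²He_{2n} + He_{2n})·He_{2n+2})(y) · e^{−y²/2}`, `c_n = 2^{1/4}((2n)!)^{−1/2}` (plumbing). [folklore] -/
private theorem eq25_integrand (n : ℕ) (x : ℝ) :
    (x * deriv (evenHermiteFn n) x + evenHermiteFn n x / 2) * evenHermiteFn (n + 1) x =
      ((2 : ℝ) ^ (1 / 4 : ℝ) / Real.sqrt ((2 * n)! : ℝ)) * ((2 : ℝ) ^ (1 / 4 : ℝ) / Real.sqrt ((2 * n + 2)! : ℝ)) / 2 *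
        (fun y : ℝ => ((2 * X * derivative (hermiteR (2 * n)) - X ^ 2 * hermiteR (2 * n) + hermiteR (2 * n)) *
            hermiteR (2 * n + 2)).eval y * Real.exp (-(y ^ 2) / 2)) (2 * Real.sqrt π * x) := by
  rw [(hasDerivAt_evenHermiteFn n x).deriv, evenHermiteFn_eq_hermiteR n x, evenHermiteFn_eq_hermiteR (n + 1) x,
    show 2 * (n + 1) = 2 * n + 2 by ring]
  have hsq : Real.sqrt π ^ 2 = π := Real.sq_sqrt Real.pi_pos.le
  have hexp : Real.exp (-π * x ^ 2) * Real.exp (-π * x ^ 2) = Real.exp (-((2 * Real.sqrt π * x) ^ 2) / 2) := by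
    rw [← Real.exp_add]; congr 1; rw [mul_pow, mul_pow, hsq]; ring
  simp only [eval_mul, eval_sub, eval_add, eval_pow, eval_X, eval_ofNat]
  rw [← hexp]
  ring_nf
  rw [hsq]

/-- `∫ f(y) e^{−y²/2} dy = √(2π) ∫ f dγ₁` for the standard Gaussian `γ₁ = gaussianReal 0 1` (plumbing). [folklore] -/
private theorem integral_mul_exp_neg_sq_half (f : ℝ → ℝ) :
    ∫ y, f y * Real.exp (-(y ^ 2) / 2) = Real.sqrt (2 * π) * ∫ y, f y ∂gaussianReal 0 1 := by
  rw [integral_gaussianReal_eq_integral_smul one_ne_zero]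
  have h : ∀ y, gaussianPDFReal 0 1 y • f y = (Real.sqrt (2 * π))⁻¹ * (f y * Real.exp (-(y ^ 2) / 2)) := by
    intro y
    simp only [gaussianPDFReal, NNReal.coe_one, mul_one, sub_zero, smul_eq_mul]
    ring
  simp_rw [h, integral_const_mul]
  rw [← mul_assoc, mul_inv_cancel₀ (by positivity), one_mul]

/-- "using the orthonormal property of the `h_n`": `∫ (2XHe_{2n}' − X²He_{2n} + He_{2n}) He_{2n+2} dγ₁ = −(2n+2)!`
(tree `integral_hermiteR_mul_hermiteR`: `∫ He_m He_k dγ₁ = k! δ_{mk}`). [cite: ConnesConsaniMoscovici2024, Prop. 3.3 (proof) eq. (25) p. 12 (p0009:L44–L59)] -/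
theorem integral_scaling_hermiteR (n : ℕ) :
    ∫ y, ((2 * X * derivative (hermiteR (2 * n)) - X ^ 2 * hermiteR (2 * n) + hermiteR (2 * n)) *
        hermiteR (2 * n + 2)).eval y ∂gaussianReal 0 1 = -((2 * n + 2)! : ℝ) := by
  rw [hermiteR_scaling_identity]
  have h : ∀ y : ℝ, ((-hermiteR (2 * n + 2) + ((2 * n * (2 * n - 1) : ℕ) : ℝ[X]) * hermiteR (2 * n - 2)) *
      hermiteR (2 * n + 2)).eval y =
      -((hermiteR (2 * n + 2)).eval y * (hermiteR (2 * n + 2)).eval y) +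
        ((2 * n * (2 * n - 1) : ℕ) : ℝ) * ((hermiteR (2 * n + 2)).eval y * (hermiteR (2 * n - 2)).eval y) := by
    intro y
    simp only [eval_mul, eval_add, eval_neg, eval_natCast]
    ring
  simp_rw [h]
  rw [integral_add, integral_neg, integral_const_mul, integral_hermiteR_mul_hermiteR, integral_hermiteR_mul_hermiteR,
    if_pos rfl, if_neg (by omega)]
  · push_cast; ring
  · exact (integrable_eval_mul_eval_gaussianReal _ _ 0 1).neg
  · exact (integrable_eval_mul_eval_gaussianReal _ _ 0 1).const_mul _

/-- The constant of eq. (25) (`s_a = ((2n)!)^{1/2}`, `s_c = ((2n+1)(2n+2))^{1/2}`; plumbing). [folklore] -/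
private theorem eq25_constant (sa sc : ℝ) (hsa : 0 < sa) :
    Real.sqrt 2 / (sa * (sc * sa)) / 2 * ((2 * Real.sqrt π)⁻¹ * (Real.sqrt (2 * π) * -(sc ^ 2 * sa ^ 2))) =
      -(1 / 2) * sc := by
  have hpi : 0 < Real.sqrt π := Real.sqrt_pos.mpr Real.pi_pos
  have h2 : Real.sqrt (2 * π) = Real.sqrt 2 * Real.sqrt π := Real.sqrt_mul (by norm_num) π
  have hs2 : Real.sqrt 2 * Real.sqrt 2 = 2 := Real.mul_self_sqrt (by norm_num)
  rw [h2]
  field_simp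
  linear_combination (-(sc)) * hs2

/-- **Discharge of the named fact `CCM2024_eq_25`** (eq. (25): `⟨(H + ½)h_{2n}, h_{2n+2}⟩ = −½√((2n+1)(2n+2))` in
real `L²(ℝ, dx)`, typed in `ProlateWaveCyclicPairs.lean` by seat t12).  Printed proof followed: highest term of
`(H + ½)h_{2n}` against `h_{2n+2}` plus orthonormality — here in the coordinates `y = 2√πx` of the PROVED eq. (21):
substitution `∫ F(2√πx)dx = (2√π)⁻¹∫F` (`Measure.integral_comp_mul_left`), Gaussian weight `e^{−y²/2}dy = √(2π)dγ₁`,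
and `hermiteR_scaling_identity` + `integral_hermiteR_mul_hermiteR`. [cite: ConnesConsaniMoscovici2024, Prop. 3.3 (proof) eq. (25) p. 12 (p0009:L44–L59)] -/
theorem CCM2024_eq_25_holds : CCM2024_eq_25 := by
  intro n
  set P : ℝ[X] := (2 * X * derivative (hermiteR (2 * n)) - X ^ 2 * hermiteR (2 * n) + hermiteR (2 * n)) *
    hermiteR (2 * n + 2) with hP
  set Φ : ℝ → ℝ := fun y => P.eval y * Real.exp (-(y ^ 2) / 2) with hΦ
  have hpt : ∀ x : ℝ, (x * deriv (evenHermiteFn n) x + evenHermiteFn n x / 2) * evenHermiteFn (n + 1) x =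
      ((2 : ℝ) ^ (1 / 4 : ℝ) / Real.sqrt ((2 * n)! : ℝ)) * ((2 : ℝ) ^ (1 / 4 : ℝ) / Real.sqrt ((2 * n + 2)! : ℝ)) / 2 *
        Φ (2 * Real.sqrt π * x) := fun x => eq25_integrand n x
  have hI : (∫ x, (x * deriv (evenHermiteFn n) x + evenHermiteFn n x / 2) * evenHermiteFn (n + 1) x) =
      ∫ x, ((2 : ℝ) ^ (1 / 4 : ℝ) / Real.sqrt ((2 * n)! : ℝ)) * ((2 : ℝ) ^ (1 / 4 : ℝ) / Real.sqrt ((2 * n + 2)! : ℝ)) / 2 *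
        Φ (2 * Real.sqrt π * x) := by
    congr 1; funext x; exact hpt x
  rw [hI, integral_const_mul, Measure.integral_comp_mul_left Φ, smul_eq_mul, hΦ, integral_mul_exp_neg_sq_half, hP,
    integral_scaling_hermiteR]
  -- constants
  have hq : (2 : ℝ) ^ (1 / 4 : ℝ) * (2 : ℝ) ^ (1 / 4 : ℝ) = Real.sqrt 2 := by
    rw [← Real.rpow_add two_pos, Real.sqrt_eq_rpow]; norm_num
  have hb : (((2 * n + 2)! : ℕ) : ℝ) = ((2 * n + 1) * (2 * n + 2) : ℝ) * ((2 * n)! : ℝ) := by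
    rw [show 2 * n + 2 = (2 * n + 1) + 1 by ring, Nat.factorial_succ, Nat.factorial_succ]; push_cast; ring
  have hsb : Real.sqrt (((2 * n + 2)! : ℕ) : ℝ) = Real.sqrt ((2 * n + 1) * (2 * n + 2) : ℝ) * Real.sqrt ((2 * n)! : ℝ) := by
    rw [hb, Real.sqrt_mul (by positivity)]
  have habs : |(2 * Real.sqrt π)⁻¹| = (2 * Real.sqrt π)⁻¹ := abs_of_pos (by positivity)
  have hprod : (((2 * n + 2)! : ℕ) : ℝ) = Real.sqrt ((2 * n + 1) * (2 * n + 2) : ℝ) ^ 2 * Real.sqrt ((2 * n)! : ℝ) ^ 2 := by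
    rw [Real.sq_sqrt (by positivity), Real.sq_sqrt (by positivity), hb]
  rw [hsb, habs, div_mul_div_comm, hq, hprod]
  exact eq25_constant _ _ (Real.sqrt_pos.mpr (by positivity))

end Eq25

end Literature.NumberTheory.ConnesConsani2024
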